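import Literature.Probability.RandomPlanarGeometry.HexSAWStripBetaCoefficientAllWidths
import HarnessLib

/-!
# The mean number of surface contacts of a critical strip walk diverges like `y_T/(y_T − y)` (module «MEAN-CONTACTS»)

Topic `Literature/Probability/RandomPlanarGeometry` (continues «BETA-COEFF-ALL-T» `HexSAWStripBetaCoefficientAllWidths.lean` — for every
`T ≥ 1`: `∃ Λ_T > 0` with `β_{T,m} y_T^m → Λ_T` and `(y_T − y) B_T(x_c; y) → Λ_T y_T` —, and `HexSAWStripSurfaceRadius.lean`
(`HV.stripBcoeff`, `HV.stripByLim_eq_tsum`)).  Lane «pcv-sawmu» (CriticalPhenomena venture), a-p2 g21.  Source of the SETTING: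
N. R. Beaton, M. Bousquet-Mélou, J. de Gier, H. Duminil-Copin, A. J. Guttmann, CMP 326 (2014) §3.2 (arXiv:1109.0358v5 p. 12: the variable `y`
of `B_T(x; y)` is conjugate to the number of contacts with the upper boundary) and Corollary 8 (the radius `y_T`); W. Feller, vol. II
(1971) XIII.5 (Abelian theorems for power series).  Nothing of the kind is printed for the strip.

## What is proved (namespace `Literature.Probability.RandomPlanarGeometry.SAW.HV`; `y_T = stripYT T`)

* §1 `hasSum_nat_mul_pow` (`Σ_m m s^m = s/(1−s)²`); ★ `tendsto_one_sub_sq_mul_tsum` — the ABELIAN LEMMA OF INDEX TWO: if `0 ≤ q_m → Λ` then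
  `(1 − s)² Σ_m m q_m s^m → Λ` as `s ↑ 1` (an `ε/4`-argument: main term `Λ s`, head killed by `(1−s)²`, tail by `(1−s)² Σ m s^m = s`).
* §2 ★★ `exists_tendsto_sub_sq_mul_tsum_mul_stripBcoeff` — `(y_T − y)² · Σ_m m β_{T,m} y^m ⟶ Λ_T y_T²` (every `T ≥ 1`), together with the
  coefficient law and the residue for the SAME `Λ_T`; ★★★ `tendsto_sub_mul_meanContacts` — with
  `⟨m⟩_{T,y} = (Σ_m m β_{T,m} y^m)/B_T(x_c; y)` the mean number of surface contacts:  `(y_T − y) · ⟨m⟩_{T,y} ⟶ y_T` as `y ↑ y_T`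
  (every `T ≥ 1`): the adsorbed fraction of a long critical strip walk diverges at the threshold with the exponent of a simple pole,
  and the amplitude `Λ_T` cancels — a universal (in `T`) form `⟨m⟩ ∼ y_T/(y_T − y)`.

Label: LANE THEOREM (own result of lane «pcv-sawmu», a-p2 g21, 2026-08-26).  NOT claimed: higher moments / fluctuations, uniformity in `T`.
-/

noncomputable section

open Finset Filter Topology Literature.Probability.LatticeModels Literature.Probability.Percolation

namespace Literature.Probability.RandomPlanarGeometry.SAW

namespace HV

/-! ### §1 An Abelian lemma of index two: `(1 − s)² Σ_m m q_m s^m → Λ` when `q_m → Λ` -/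

/-- `Σ_m m s^m = s/(1 − s)²` as a `HasSum`, for `0 ≤ s < 1` (plumbing; Mathlib `tsum_coe_mul_geometric_of_norm_lt_one`).
[cite: Feller1971, XIII.5 (power series with regularly varying coefficients); lane plumbing] -/
theorem hasSum_nat_mul_pow {s : ℝ} (hs0 : 0 ≤ s) (hs1 : s < 1) : HasSum (fun m : ℕ => (m : ℝ) * s ^ m) (s / (1 - s) ^ 2) := by
  have hs : ‖s‖ < 1 := by rw [Real.norm_of_nonneg hs0]; exact hs1
  have hsum : Summable fun m : ℕ => (m : ℝ) * s ^ m :=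
    (summable_pow_mul_geometric_of_norm_lt_one 1 hs).congr fun m => by simp [pow_one]
  rw [← tsum_coe_mul_geometric_of_norm_lt_one hs]
  exact hsum.hasSum

set_option maxHeartbeats 400000 in
/-- ★ **Abelian lemma, index two**: if `0 ≤ q_m → Λ` then `(1 − s)² · Σ_m m q_m s^m ⟶ Λ` as `s ↑ 1`
(split `q = Λ + r`: the main term is `Λ s`, the head of `r` is killed by `(1 − s)²`, its tail by `(1 − s)² Σ_m m s^m = s ≤ 1`).
[cite: Feller1971, XIII.5 Theorem 5 (the easy, Abelian half, index 2); lane plumbing] -/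
theorem tendsto_one_sub_sq_mul_tsum {q : ℕ → ℝ} (hq0 : ∀ m, 0 ≤ q m) {Λ : ℝ} (hlim : Tendsto q atTop (𝓝 Λ)) :
    Tendsto (fun s : ℝ => (1 - s) ^ 2 * ∑' m : ℕ, (m : ℝ) * q m * s ^ m) (𝓝[<] 1) (𝓝 Λ) := by
  -- a uniform bound `q m ≤ K`
  obtain ⟨K, hK⟩ := hlim.bddAbove_range
  have hqK : ∀ m, q m ≤ K := fun m => hK ⟨m, rfl⟩
  have hK0 : 0 ≤ K := (hq0 0).trans (hqK 0)
  have hΛ0 : 0 ≤ Λ := ge_of_tendsto' hlim hq0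
  rw [Metric.tendsto_nhdsWithin_nhds]
  intro ε hε
  obtain ⟨M, hM⟩ := Metric.tendsto_atTop.1 hlim (ε / 4) (by positivity)
  set C : ℝ := ∑ m ∈ range M, (m : ℝ) * (K + Λ) with hC
  have hC0 : 0 ≤ C := sum_nonneg fun m _ => mul_nonneg (Nat.cast_nonneg _) (by positivity)
  obtain ⟨δ, hδ0, hδ1, hδ⟩ : ∃ δ : ℝ, 0 < δ ∧ δ ≤ 1 ∧ δ * (C + Λ + 1) ≤ ε / 4 := by
    refine ⟨min 1 (ε / 4 / (C + Λ + 1)), lt_min one_pos (by positivity), min_le_left _ _, ?_⟩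
    calc min 1 (ε / 4 / (C + Λ + 1)) * (C + Λ + 1) ≤ ε / 4 / (C + Λ + 1) * (C + Λ + 1) :=
          mul_le_mul_of_nonneg_right (min_le_right _ _) (by positivity)
      _ = ε / 4 := div_mul_cancel₀ _ (by positivity)
  refine ⟨δ, hδ0, fun s hs1 hds => ?_⟩
  rw [Set.mem_Iio] at hs1
  rw [Real.dist_eq, abs_sub_lt_iff] at hds
  have hs0 : 0 ≤ s := by linarith
  have h1s : 0 < 1 - s := sub_pos.2 hs1
  have h1sδ : 1 - s < δ := by linarith
  -- summability of the pieces
  have hgeom := hasSum_nat_mul_pow hs0 hs1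
  have hsn : Summable fun m : ℕ => (m : ℝ) * s ^ m := hgeom.summable
  have hsq : Summable fun m : ℕ => (m : ℝ) * q m * s ^ m := by
    refine (hsn.mul_left K).of_nonneg_of_le (fun m => mul_nonneg (mul_nonneg (Nat.cast_nonneg _) (hq0 m)) (pow_nonneg hs0 _))
      fun m => ?_
    calc (m : ℝ) * q m * s ^ m ≤ (m : ℝ) * K * s ^ m :=
          mul_le_mul_of_nonneg_right (mul_le_mul_of_nonneg_left (hqK m) (Nat.cast_nonneg _)) (pow_nonneg hs0 _)
      _ = K * ((m : ℝ) * s ^ m) := by ring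
  have hsr : Summable fun m : ℕ => (m : ℝ) * (q m - Λ) * s ^ m := by
    have : (fun m : ℕ => (m : ℝ) * (q m - Λ) * s ^ m) = fun m : ℕ => (m : ℝ) * q m * s ^ m - Λ * ((m : ℝ) * s ^ m) := by
      funext m; ring
    rw [this]; exact hsq.sub (hsn.mul_left Λ)
  -- decomposition of the error
  have hdec : (1 - s) ^ 2 * ∑' m : ℕ, (m : ℝ) * q m * s ^ m - Λ =
      (1 - s) ^ 2 * ∑' m : ℕ, (m : ℝ) * (q m - Λ) * s ^ m - Λ * (1 - s) := by
    have h1 : ∑' m : ℕ, (m : ℝ) * q m * s ^ m = ∑' m : ℕ, (m : ℝ) * (q m - Λ) * s ^ m + Λ * ∑' m : ℕ, (m : ℝ) * s ^ m := by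
      rw [← tsum_mul_left, ← hsr.tsum_add (hsn.mul_left Λ)]
      exact tsum_congr fun m => by ring
    have h2 : (1 - s) ^ 2 * (s / (1 - s) ^ 2) = s := by field_simp
    rw [h1, hgeom.tsum_eq, mul_add, ← mul_assoc ((1 - s) ^ 2) Λ, mul_comm ((1 - s) ^ 2) Λ, mul_assoc, h2]
    ring
  rw [Real.dist_eq, hdec]
  -- head / tail split of the error series at `M`
  have hsplit := (Summable.sum_add_tsum_nat_add M hsr).symm
  have hsr' : Summable fun m : ℕ => ((m + M : ℕ) : ℝ) * (q (m + M) - Λ) * s ^ (m + M) := (summable_nat_add_iff M).2 hsr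
  have hsn' : Summable fun m : ℕ => ((m + M : ℕ) : ℝ) * s ^ (m + M) := (summable_nat_add_iff M).2 hsn
  have htail_le : ∑' m : ℕ, ((m + M : ℕ) : ℝ) * s ^ (m + M) ≤ s / (1 - s) ^ 2 := by
    rw [← hgeom.tsum_eq]
    have h := Summable.sum_add_tsum_nat_add M hsn
    have hh : 0 ≤ ∑ m ∈ range M, (m : ℝ) * s ^ m := sum_nonneg fun m _ => mul_nonneg (Nat.cast_nonneg _) (pow_nonneg hs0 _)
    linarith
  have htail : |∑' m : ℕ, ((m + M : ℕ) : ℝ) * (q (m + M) - Λ) * s ^ (m + M)| ≤ ε / 4 * (s / (1 - s) ^ 2) := by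
    calc |∑' m : ℕ, ((m + M : ℕ) : ℝ) * (q (m + M) - Λ) * s ^ (m + M)|
        ≤ ∑' m : ℕ, |((m + M : ℕ) : ℝ) * (q (m + M) - Λ) * s ^ (m + M)| := by
          have := norm_tsum_le_tsum_norm hsr'.norm
          simpa only [Real.norm_eq_abs] using this
      _ ≤ ∑' m : ℕ, ε / 4 * (((m + M : ℕ) : ℝ) * s ^ (m + M)) := by
          refine hsr'.abs.tsum_le_tsum (fun m => ?_) (hsn'.mul_left _)
          rw [abs_mul, abs_mul, abs_of_nonneg (Nat.cast_nonneg _), abs_of_nonneg (pow_nonneg hs0 _)]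
          have hq : |q (m + M) - Λ| ≤ ε / 4 := by
            have := hM (m + M) (by omega); rw [Real.dist_eq] at this; exact this.le
          calc (((m + M : ℕ) : ℝ)) * |q (m + M) - Λ| * s ^ (m + M) ≤ ((m + M : ℕ) : ℝ) * (ε / 4) * s ^ (m + M) :=
                mul_le_mul_of_nonneg_right (mul_le_mul_of_nonneg_left hq (Nat.cast_nonneg _)) (pow_nonneg hs0 _)
            _ = ε / 4 * (((m + M : ℕ) : ℝ) * s ^ (m + M)) := by ring
      _ = ε / 4 * ∑' m : ℕ, ((m + M : ℕ) : ℝ) * s ^ (m + M) := tsum_mul_left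
      _ ≤ ε / 4 * (s / (1 - s) ^ 2) := mul_le_mul_of_nonneg_left htail_le (by positivity)
  have hhead : |∑ m ∈ range M, (m : ℝ) * (q m - Λ) * s ^ m| ≤ C := by
    refine (abs_sum_le_sum_abs _ _).trans (sum_le_sum fun m _ => ?_)
    rw [abs_mul, abs_mul, abs_of_nonneg (Nat.cast_nonneg m), abs_of_nonneg (pow_nonneg hs0 _)]
    have hq : |q m - Λ| ≤ K + Λ := by
      rw [abs_le]; constructor <;> linarith [hq0 m, hqK m]
    calc (m : ℝ) * |q m - Λ| * s ^ m ≤ (m : ℝ) * (K + Λ) * 1 :=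
          mul_le_mul (mul_le_mul_of_nonneg_left hq (Nat.cast_nonneg _)) (pow_le_one₀ hs0 hs1.le) (pow_nonneg hs0 _)
            (mul_nonneg (Nat.cast_nonneg _) (by positivity))
      _ = (m : ℝ) * (K + Λ) := mul_one _
  have herr : |∑' m : ℕ, (m : ℝ) * (q m - Λ) * s ^ m| ≤ C + ε / 4 * (s / (1 - s) ^ 2) := by
    rw [hsplit]; exact (abs_add_le _ _).trans (add_le_add hhead htail)
  -- assemble
  have hmain : |(1 - s) ^ 2 * ∑' m : ℕ, (m : ℝ) * (q m - Λ) * s ^ m - Λ * (1 - s)| ≤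
      (1 - s) ^ 2 * C + ε / 4 * s + Λ * (1 - s) := by
    have h1 : |(1 - s) ^ 2 * ∑' m : ℕ, (m : ℝ) * (q m - Λ) * s ^ m| ≤ (1 - s) ^ 2 * C + ε / 4 * s := by
      rw [abs_mul, abs_of_nonneg (sq_nonneg _)]
      have := mul_le_mul_of_nonneg_left herr (sq_nonneg (1 - s))
      have h2 : (1 - s) ^ 2 * (ε / 4 * (s / (1 - s) ^ 2)) = ε / 4 * s := by field_simp
      linarith [h2]
    have h3 : |Λ * (1 - s)| = Λ * (1 - s) := abs_of_nonneg (mul_nonneg hΛ0 h1s.le)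
    calc |(1 - s) ^ 2 * ∑' m : ℕ, (m : ℝ) * (q m - Λ) * s ^ m - Λ * (1 - s)|
        ≤ |(1 - s) ^ 2 * ∑' m : ℕ, (m : ℝ) * (q m - Λ) * s ^ m| + |Λ * (1 - s)| := abs_sub _ _
      _ ≤ (1 - s) ^ 2 * C + ε / 4 * s + Λ * (1 - s) := by rw [h3]; linarith
  have h4a : (1 - s) ^ 2 ≤ δ := by
    have hA : (1 - s) * (1 - s) ≤ δ * 1 := mul_le_mul h1sδ.le (by linarith) h1s.le hδ0.le
    rw [sq]; linarith
  have h4 : (1 - s) ^ 2 * C ≤ δ * C := mul_le_mul_of_nonneg_right h4a hC0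
  have h5 : Λ * (1 - s) ≤ δ * Λ := by rw [mul_comm δ]; exact mul_le_mul_of_nonneg_left h1sδ.le hΛ0
  have h6 : ε / 4 * s ≤ ε / 4 := mul_le_of_le_one_right (by positivity) hs1.le
  have h7 : δ * C + δ * Λ + δ ≤ ε / 4 := by linarith [hδ, show δ * (C + Λ + 1) = δ * C + δ * Λ + δ by ring]
  linarith


/-! ### §2 ★★★ The mean number of surface contacts diverges like `y_T/(y_T − y)` -/

variable {T : ℕ}

/-- ★★ **Second-order Abelian limit of the β-series**: `(y_T − y)² · Σ_m m β_{T,m} y^m ⟶ Λ_T · y_T²` as `y ↑ y_T` (every `T ≥ 1`), with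
the `Λ_T > 0` of the coefficient law (`exists_pos_tendsto_stripBcoeff_mul_pow_of_one_le`); i.e. `y B_T′(x_c; y)` has a DOUBLE pole at `y_T`
with coefficient `Λ_T y_T²`. [cite: Feller1971, XIII.5 Theorem 5 (Abelian half, index 2); BeatonBousquetMelouDeGierDuminilCopinGuttmann2014, Corollary 8 (arXiv v5 p. 12); lane «pcv-sawmu» a-p2 g21 — own] -/
theorem exists_tendsto_sub_sq_mul_tsum_mul_stripBcoeff (hT : 1 ≤ T) :
    ∃ Λ : ℝ, 0 < Λ ∧ Tendsto (fun m : ℕ => stripBcoeff T m * stripYT T ^ m) atTop (𝓝 Λ) ∧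
      Tendsto (fun y : ℝ => (stripYT T - y) * stripByLim T y) (𝓝[<] stripYT T) (𝓝 (Λ * stripYT T)) ∧
      Tendsto (fun y : ℝ => (stripYT T - y) ^ 2 * ∑' m : ℕ, (m : ℝ) * stripBcoeff T m * y ^ m) (𝓝[<] stripYT T)
        (𝓝 (Λ * stripYT T ^ 2)) := by
  obtain ⟨Λ, hΛ, hq, hres⟩ := exists_tendsto_sub_mul_stripByLim_of_one_le hT
  have hyT := one_lt_stripYT hT
  have hy : 0 < stripYT T := by linarith
  refine ⟨Λ, hΛ, hq, hres, ?_⟩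
  have hq0 : ∀ m, 0 ≤ stripBcoeff T m * stripYT T ^ m := fun m => mul_nonneg (stripBcoeff_nonneg hT m) (pow_nonneg hy.le _)
  have hA := tendsto_one_sub_sq_mul_tsum hq0 hq
  have hsub : Tendsto (fun y : ℝ => y / stripYT T) (𝓝[<] stripYT T) (𝓝[<] 1) := by
    refine tendsto_nhdsWithin_of_tendsto_nhds_of_eventually_within _ ?_ ?_
    · have : Tendsto (fun y : ℝ => y / stripYT T) (𝓝 (stripYT T)) (𝓝 (stripYT T / stripYT T)) := tendsto_id.div_const _
      rw [div_self hy.ne'] at this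
      exact this.mono_left nhdsWithin_le_nhds
    · filter_upwards [self_mem_nhdsWithin] with y hy'
      exact (div_lt_one hy).2 hy'
  have h1 := (hA.comp hsub).mul_const (stripYT T ^ 2)
  refine h1.congr' ?_
  filter_upwards [self_mem_nhdsWithin] with y _
  simp only [Function.comp]
  have hterm : ∀ m : ℕ, (m : ℝ) * (stripBcoeff T m * stripYT T ^ m) * (y / stripYT T) ^ m = (m : ℝ) * stripBcoeff T m * y ^ m := by
    intro m
    rw [div_pow, mul_assoc, mul_assoc, mul_div_assoc', mul_div_cancel_left₀ _ (pow_ne_zero _ hy.ne'), mul_assoc]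
  simp_rw [hterm]
  have h2 : (1 - y / stripYT T) ^ 2 * stripYT T ^ 2 = (stripYT T - y) ^ 2 := by field_simp
  rw [← h2]
  ring

/-- ★★★ **THE MEAN NUMBER OF SURFACE CONTACTS DIVERGES LIKE `y_T/(y_T − y)`** (every `T ≥ 1`): with
`⟨m⟩_{T,y} := (Σ_m m β_{T,m} y^m) / B_T(x_c; y)` the mean number of contacts with the upper boundary of a walk of the width-`T` strip
from the mid-edge `a` to that boundary, under the weight `x_c^{|ω|} y^{#contacts}` (`y < y_T`):
`(y_T − y) · ⟨m⟩_{T,y} ⟶ y_T` as `y ↑ y_T` — the adsorbed fraction of a long critical strip walk blows up at the threshold with the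
exponent of a simple pole (ratio of the index-2 and index-1 Abelian limits; the constant `Λ_T` cancels).
[cite: BeatonBousquetMelouDeGierDuminilCopinGuttmann2014, §3.2 and Corollary 8 (arXiv v5 p. 12: y conjugate to the surface contacts, radius y_T); Feller1971, XIII.5 Theorem 5; lane «pcv-sawmu» a-p2 g21 — own result] -/
theorem tendsto_sub_mul_meanContacts (hT : 1 ≤ T) :
    Tendsto (fun y : ℝ => (stripYT T - y) * ((∑' m : ℕ, (m : ℝ) * stripBcoeff T m * y ^ m) / stripByLim T y))
      (𝓝[<] stripYT T) (𝓝 (stripYT T)) := by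
  obtain ⟨Λ, hΛ, -, hB, hN⟩ := exists_tendsto_sub_sq_mul_tsum_mul_stripBcoeff hT
  have hyT := one_lt_stripYT hT
  have hy : 0 < stripYT T := by linarith
  have hne : Λ * stripYT T ≠ 0 := by positivity
  have h := hN.div hB hne
  rw [show Λ * stripYT T ^ 2 / (Λ * stripYT T) = stripYT T by field_simp] at h
  refine h.congr' ?_
  filter_upwards [self_mem_nhdsWithin] with y hy'
  have hne' : stripYT T - y ≠ 0 := (sub_pos.2 hy').ne'
  simp only [Pi.div_apply]
  by_cases hB0 : stripByLim T y = 0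
  · simp [hB0]
  · field_simp

end HV

end Literature.Probability.RandomPlanarGeometry.SAW
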